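import Summits.AtomisticToContinuum.Crystallization.Theses.PalmUnimodularRigidity
import Summits.AtomisticToContinuum.Crystallization.Theorems.MinimiserShells.Negative.LoadBearing
import Summits.AtomisticToContinuum.Crystallization.Theorems.MinimiserShells.Negative.Rootedness
import Summits.AtomisticToContinuum.Crystallization.Theorems.PalmUnimodularRigidityMinimiserShellsEquilibriumInLawKernel
import Literature.Probability.Process.PointStationaryLaw
import Literature.MathematicalPhysics.StatisticalMechanics.RootEnergy
import Literature.MathematicalPhysics.StatisticalMechanics.MuGSC

/-!
# The gain events: measurable sets of configurations admitting a gaining modification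

Helper file for stub `stub_equilibriumInLaw` (S1) of line `equilibrium-in-law-surgery`, crux
`MinimiserShells` (stmt-AtomisticToContinuum-9225): blueprint lemma 8c–8d.

For a modification TYPE `ι = (n₀, k, r, ε, R')` — remove `n₀` atoms within `r` of the root,
insert the FIXED configuration `R' : Fin k → ℝ³`, gain `≥ ε` in Sütő's functional at chemical
potential `e*` — we define

* `fieldOff μ x q = ∫ 1[z ∉ range x] V_LJ(|q − z|) d(lfKernel μ)(z)` — the field of the
  configuration minus the removed points `x`, seen from `q` (an integral against the s-finite
  regularisation `lfKernel μ`, so that it is jointly measurable in `(μ, x)`);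
* `gainSet n₀ k r ε R' ⊆ Measure E3 × (Fin n₀ → E3)` — the pairs `(μ, x)` such that removing `x`
  and inserting `R'` is an admissible modification gaining `≥ ε` (MEASURABLE:
  `measurableSet_gainSet`);
* `gainCount n₀ k r ε R' μ = ∫ 1_{gainSet}(μ, x) d(piKernel n₀ μ)(x)` — the number of gaining
  removals (MEASURABLE in `μ`: `measurable_gainCount`).

For the counting measure of a separated set `S` these read back as Sütő's data:
`fieldOff count|S x q = ∑_{z ∈ S ∖ range x} V_LJ(|q − z|)` (`fieldOff_count_restrict`), and
`gainCount … count|S ≠ 0 ↔` some injective `xf ⊆ S ∩ B̄(0, r)` makes `(xf → R')` a modification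
violating Sütő's inequality by `≥ ε` (`exists_gain_of_gainCount_ne_zero`,
`gainCount_ne_zero_of_gain`).
-/

noncomputable section

open MeasureTheory ProbabilityTheory
open scoped ENNReal BigOperators

namespace Summit.AtomisticToContinuum.Crystallization.Theorems.PalmUnimodularRigidityMinimiserShells.EquilibriumInLaw.GainEvent

open Literature.Probability.Process (IsPointStationaryLaw IsRootedHardCore count_restrict_singleton_ne_zero_iff
  map_sub_count_restrict)
open Literature.MathematicalPhysics.StatisticalMechanics (lennardJones IsMuGSC UniformlyDiscrete)
open Summit.AtomisticToContinuum.Crystallization.Theses.PalmUnimodularRigidity (MinimiserShells UnimodularEnergyLowerBound)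
open Summit.AtomisticToContinuum.Crystallization.Theorems.MinimiserShells.Negative.LoadBearing
  (eStar meanRootEnergy GoodShell minimiserShells_iff)
open Literature.MathematicalPhysics.StatisticalMechanics (interactionEnergy fieldEnergy fieldEnergy_eq)
open Summit.AtomisticToContinuum.Crystallization.Theorems.MinimiserShells.Negative.Rootedness (E3
  countable_of_separated)
open Summit.AtomisticToContinuum.Crystallization.Theorems.PalmUnimodularRigidityMinimiserShells.EquilibriumInLaw.LfKernel
  (lfKernel piKernel lfKernel_count_restrict lintegral_piKernel_eq_zero_iff lintegral_count_restrict)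

/-! ## Measurability of the ingredients -/

/-- The Lennard-Jones potential is a measurable function. -/
theorem measurable_lennardJones : Measurable lennardJones := by
  show Measurable fun r : ℝ => (1 / 12) * (r⁻¹) ^ 12 - (1 / 6) * (r⁻¹) ^ 6
  exact ((measurable_inv.pow_const 12).const_mul _).sub ((measurable_inv.pow_const 6).const_mul _)

/-- The interaction energy is a measurable function of the configuration. -/
theorem measurable_interactionEnergy (n : ℕ) :
    Measurable fun x : Fin n → E3 => interactionEnergy lennardJones x := by
  unfold interactionEnergy
  refine Finset.measurable_sum _ fun i _ => Finset.measurable_sum _ fun j _ => ?_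
  exact measurable_lennardJones.comp ((measurable_pi_apply i).dist (measurable_pi_apply j))

/-- Injective configurations form an open set. -/
theorem isOpen_setOf_injective (n : ℕ) : IsOpen {x : Fin n → E3 | Function.Injective x} := by
  have hrepr : {x : Fin n → E3 | Function.Injective x} = ⋂ i : Fin n, ⋂ j : Fin n, {x | i = j ∨ x i ≠ x j} := by
    ext x
    simp only [Set.mem_setOf_eq, Set.mem_iInter]
    constructor
    · intro h i j
      exact (eq_or_ne i j).imp_right fun hij => h.ne hij
    · intro h i j hij
      exact (h i j).resolve_right fun hne => hne hij
  rw [hrepr]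
  refine isOpen_iInter_of_finite fun i => isOpen_iInter_of_finite fun j => ?_
  by_cases hij : i = j
  · have : {x : Fin n → E3 | i = j ∨ x i ≠ x j} = Set.univ := Set.eq_univ_of_forall fun _ => Or.inl hij
    rw [this]
    exact isOpen_univ
  · have : {x : Fin n → E3 | i = j ∨ x i ≠ x j} = {x | x i ≠ x j} := by
      ext x
      simp [hij]
    rw [this]
    exact isOpen_ne_fun (continuous_apply i) (continuous_apply j)

/-- Injective configurations form a measurable set. -/
theorem measurableSet_setOf_injective (n : ℕ) :
    MeasurableSet {x : Fin n → E3 | Function.Injective x} :=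
  (isOpen_setOf_injective n).measurableSet

/-! ## The field off the removed points -/

/-- The field of `μ` minus the removed points `x`, seen from `q`:
`∫ 1[z ∉ range x] V_LJ(|q − z|) d(lfKernel μ)(z)` (Bochner integral against the s-finite
regularisation of `μ`). -/
def fieldOff {n₀ : ℕ} (μ : Measure E3) (x : Fin n₀ → E3) (q : E3) : ℝ :=
  ∫ z, (Set.range x)ᶜ.indicator (fun z => lennardJones (dist q z)) z ∂(lfKernel μ)

/-- The integrand of `fieldOff` is jointly measurable in `((μ, x), z)`, for a measurable choice
`Q (μ, x)` of the viewpoint. -/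
theorem measurable_fieldOff_integrand {n₀ : ℕ} {Q : Measure E3 × (Fin n₀ → E3) → E3} (hQ : Measurable Q) :
    Measurable fun pz : (Measure E3 × (Fin n₀ → E3)) × E3 =>
      (Set.range pz.1.2)ᶜ.indicator (fun z => lennardJones (dist (Q pz.1) z)) pz.2 := by
  set T : Set ((Measure E3 × (Fin n₀ → E3)) × E3) := {pz | pz.2 ∈ Set.range pz.1.2} with hT
  have hTm : MeasurableSet T := by
    have hrepr : T = ⋃ l : Fin n₀, {pz : (Measure E3 × (Fin n₀ → E3)) × E3 | pz.1.2 l = pz.2} := by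
      ext pz
      simp only [hT, Set.mem_setOf_eq, Set.mem_range, Set.mem_iUnion]
    rw [hrepr]
    exact MeasurableSet.iUnion fun l =>
      measurableSet_eq_fun ((measurable_pi_apply l).comp (measurable_snd.comp measurable_fst)) measurable_snd
  have hG : Measurable fun pz : (Measure E3 × (Fin n₀ → E3)) × E3 => lennardJones (dist (Q pz.1) pz.2) :=
    measurable_lennardJones.comp ((hQ.comp measurable_fst).dist measurable_snd)
  have heq : (fun pz : (Measure E3 × (Fin n₀ → E3)) × E3 =>
      (Set.range pz.1.2)ᶜ.indicator (fun z => lennardJones (dist (Q pz.1) z)) pz.2) =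
      Tᶜ.indicator fun pz => lennardJones (dist (Q pz.1) pz.2) := by
    funext pz
    simp only [Set.indicator_apply, Set.mem_compl_iff, hT, Set.mem_setOf_eq]
  rw [heq]
  exact hG.indicator hTm.compl

/-- **Joint measurability of the field** `(μ, x) ↦ fieldOff μ x (Q (μ, x))` for a measurable
viewpoint `Q` (`StronglyMeasurable.integral_kernel_prod_right'` for the s-finite kernel
`lfKernel`). -/
theorem measurable_fieldOff {n₀ : ℕ} {Q : Measure E3 × (Fin n₀ → E3) → E3} (hQ : Measurable Q) :
    Measurable fun p : Measure E3 × (Fin n₀ → E3) => fieldOff p.1 p.2 (Q p) := by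
  have h := (measurable_fieldOff_integrand hQ).stronglyMeasurable.integral_kernel_prod_right'
    (κ := Kernel.prodMkRight (Fin n₀ → E3) lfKernel)
  exact h.measurable

/-! ## The gain set and the gain count -/

/-- **The gain set** of type `(n₀, k, r, ε, R')`: pairs `(μ, x)` such that `x` is an injective
`n₀`-tuple within `r` of the root, `R'` is injective within `r` of the root and off the atoms of
`μ` other than `x`, and the modification "remove `x`, insert `R'`" violates Sütő's inequality at
chemical potential `e*` by at least `ε`. -/
def gainSet (n₀ k : ℕ) (r ε : ℝ) (R' : Fin k → E3) : Set (Measure E3 × (Fin n₀ → E3)) :=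
  {p | Function.Injective p.2 ∧ (∀ l, ‖p.2 l‖ ≤ r) ∧ Function.Injective R' ∧ (∀ i, ‖R' i‖ ≤ r) ∧
    (∀ i, lfKernel p.1 {R' i} = 0 ∨ R' i ∈ Set.range p.2) ∧
    interactionEnergy lennardJones R' + ∑ i, fieldOff p.1 p.2 (R' i) - eStar * k + ε ≤
      interactionEnergy lennardJones p.2 + ∑ l, fieldOff p.1 p.2 (p.2 l) - eStar * n₀}

/-- **The gain set is measurable.** -/
theorem measurableSet_gainSet (n₀ k : ℕ) (r ε : ℝ) (R' : Fin k → E3) :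
    MeasurableSet (gainSet n₀ k r ε R') := by
  have h1 : MeasurableSet {p : Measure E3 × (Fin n₀ → E3) | Function.Injective p.2} :=
    (measurableSet_setOf_injective n₀).preimage measurable_snd
  have h2 : MeasurableSet {p : Measure E3 × (Fin n₀ → E3) | ∀ l, ‖p.2 l‖ ≤ r} := by
    rw [Set.setOf_forall]
    exact MeasurableSet.iInter fun l =>
      measurableSet_le ((measurable_pi_apply l).comp measurable_snd).norm measurable_const
  have h3 : MeasurableSet {_p : Measure E3 × (Fin n₀ → E3) | Function.Injective R'} :=
    MeasurableSet.const _
  have h4 : MeasurableSet {_p : Measure E3 × (Fin n₀ → E3) | ∀ i, ‖R' i‖ ≤ r} :=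
    MeasurableSet.const _
  have h5 : MeasurableSet {p : Measure E3 × (Fin n₀ → E3) |
      ∀ i, lfKernel p.1 {R' i} = 0 ∨ R' i ∈ Set.range p.2} := by
    rw [Set.setOf_forall]
    refine MeasurableSet.iInter fun i => ?_
    have ha : MeasurableSet {p : Measure E3 × (Fin n₀ → E3) | lfKernel p.1 {R' i} = 0} :=
      ((Kernel.measurable_coe lfKernel (measurableSet_singleton (R' i))).comp measurable_fst)
        (measurableSet_singleton 0)
    have hb : MeasurableSet {p : Measure E3 × (Fin n₀ → E3) | R' i ∈ Set.range p.2} := by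
      have hrepr : {p : Measure E3 × (Fin n₀ → E3) | R' i ∈ Set.range p.2} =
          ⋃ l, {p : Measure E3 × (Fin n₀ → E3) | p.2 l = R' i} := by
        ext p
        simp only [Set.mem_setOf_eq, Set.mem_range, Set.mem_iUnion]
      rw [hrepr]
      exact MeasurableSet.iUnion fun l =>
        measurableSet_eq_fun ((measurable_pi_apply l).comp measurable_snd) measurable_const
    exact ha.union hb
  have h6 : MeasurableSet {p : Measure E3 × (Fin n₀ → E3) |
      interactionEnergy lennardJones R' + ∑ i, fieldOff p.1 p.2 (R' i) - eStar * k + ε ≤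
        interactionEnergy lennardJones p.2 + ∑ l, fieldOff p.1 p.2 (p.2 l) - eStar * n₀} := by
    refine measurableSet_le ?_ ?_
    · refine ((measurable_const.add (Finset.measurable_sum _ fun i _ => ?_)).sub measurable_const).add
        measurable_const
      exact measurable_fieldOff measurable_const
    · refine ((measurable_interactionEnergy n₀).comp measurable_snd).add
        (Finset.measurable_sum _ fun l _ => ?_) |>.sub measurable_const
      exact measurable_fieldOff ((measurable_pi_apply l).comp measurable_snd)
  exact h1.inter (h2.inter (h3.inter (h4.inter (h5.inter h6))))

/-- **The gain count** of type `(n₀, k, r, ε, R')`: the number of `n₀`-tuples `x` of `μ` with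
`(μ, x)` in the gain set (an integral against the `n₀`-th power `piKernel n₀ μ`). -/
def gainCount (n₀ k : ℕ) (r ε : ℝ) (R' : Fin k → E3) (μ : Measure E3) : ℝ≥0∞ :=
  ∫⁻ x, (gainSet n₀ k r ε R').indicator 1 (μ, x) ∂(piKernel n₀ μ)

/-- **The gain count is measurable** in the configuration. -/
theorem measurable_gainCount (n₀ k : ℕ) (r ε : ℝ) (R' : Fin k → E3) :
    Measurable (gainCount n₀ k r ε R') :=
  (measurable_one.indicator (measurableSet_gainSet n₀ k r ε R')).lintegral_kernel_prod_right'
    (κ := piKernel n₀)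

/-- The gain event `{μ | gainCount … μ ≠ 0}` is measurable. -/
theorem measurableSet_gainCount_ne_zero (n₀ k : ℕ) (r ε : ℝ) (R' : Fin k → E3) :
    MeasurableSet {μ : Measure E3 | gainCount n₀ k r ε R' μ ≠ 0} :=
  (measurable_gainCount n₀ k r ε R' (measurableSet_singleton 0)).compl

/-! ## Reading the gain event back on counting measures of separated sets -/

/-- Integrability against the counting measure of a countable set from absolute summability. -/
theorem integrable_count_restrict {S : Set E3} (hS : S.Countable) {f : E3 → ℝ} (hf : Measurable f)
    (hsum : Summable fun z : S => f z) : Integrable f ((Measure.count : Measure E3).restrict S) := by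
  refine ⟨hf.aestronglyMeasurable, ?_⟩
  have habs : Summable fun z : S => |f z| := hsum.abs
  rw [hasFiniteIntegral_iff_enorm, lintegral_count_restrict hS]
  simp_rw [Real.enorm_eq_ofReal_abs]
  rw [← ENNReal.ofReal_tsum_of_nonneg (fun _ => abs_nonneg _) habs]
  exact ENNReal.ofReal_lt_top

/-- Integration against the counting measure of a countable set is the sum over the set. -/
theorem integral_count_restrict {S : Set E3} (hS : S.Countable) {f : E3 → ℝ} (hf : Measurable f)
    (hsum : Summable fun z : S => f z) :
    ∫ z, f z ∂(Measure.count : Measure E3).restrict S = ∑' z : S, f z := by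
  rw [setIntegral_countable f hS (integrable_count_restrict hS hf hsum)]
  refine tsum_congr fun z => ?_
  rw [measureReal_def, Measure.count_singleton, ENNReal.toReal_one, one_smul]

/-- **The field read back.** For the counting measure of a `δ`-separated set `S`:
`fieldOff count|S x q = ∑_{z ∈ S ∖ range x} V_LJ(|q − z|)`. -/
theorem fieldOff_count_restrict {δ : ℝ} (hδ : 0 < δ) {S : Set E3}
    (hsep : ∀ x ∈ S, ∀ y ∈ S, x ≠ y → δ ≤ dist x y) {n₀ : ℕ} (x : Fin n₀ → E3) (q : E3) :
    fieldOff ((Measure.count : Measure E3).restrict S) x q =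
      ∑' z : ↥(S \ Set.range x), lennardJones (dist q z) := by
  have hS : S.Countable := countable_of_separated hδ hsep
  have hud : UniformlyDiscrete S := ⟨δ, hδ, hsep⟩
  have hfm : Measurable fun z : E3 => lennardJones (dist q z) :=
    measurable_lennardJones.comp (measurable_const.dist measurable_id)
  have hsum : Summable fun z : S => lennardJones (dist q (z : E3)) := hud.summable_lennardJones q
  have hrange : MeasurableSet (Set.range x)ᶜ := (Set.finite_range x).measurableSet.compl
  rw [fieldOff, lfKernel_count_restrict hδ hsep,
    integral_count_restrict hS (hfm.indicator hrange) ?_]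
  · rw [tsum_subtype S ((Set.range x)ᶜ.indicator fun z => lennardJones (dist q z)),
      Set.indicator_indicator, tsum_subtype (S \ Set.range x) (fun z => lennardJones (dist q z)),
      Set.sdiff_eq]
  · refine Summable.of_norm_bounded hsum.abs fun z => ?_
    rw [Real.norm_eq_abs, Set.indicator_apply]
    split_ifs
    · exact le_rfl
    · rw [abs_zero]; exact abs_nonneg _

/-- **A gaining removal exists when the gain count is non-zero** (counting measure of a separated
set): some injective `xf ⊆ S ∩ B̄(0, r)` makes "remove `xf`, insert `R'`" an admissible
modification violating Sütő's inequality at `e*` by `≥ ε`. -/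
theorem exists_gain_of_gainCount_ne_zero {δ : ℝ} (hδ : 0 < δ) {S : Set E3}
    (hsep : ∀ x ∈ S, ∀ y ∈ S, x ≠ y → δ ≤ dist x y) {n₀ k : ℕ} {r ε : ℝ} {R' : Fin k → E3}
    (h : gainCount n₀ k r ε R' ((Measure.count : Measure E3).restrict S) ≠ 0) :
    ∃ xf : Fin n₀ → E3, Function.Injective xf ∧ Set.range xf ⊆ S ∧ (∀ l, ‖xf l‖ ≤ r) ∧
      Function.Injective R' ∧ (∀ i, ‖R' i‖ ≤ r) ∧ Disjoint (Set.range R') (S \ Set.range xf) ∧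
      interactionEnergy lennardJones R' + fieldEnergy lennardJones R' (S \ Set.range xf) -
          eStar * k + ε ≤
        interactionEnergy lennardJones xf + fieldEnergy lennardJones xf (S \ Set.range xf) -
          eStar * n₀ := by
  have hS : S.Countable := countable_of_separated hδ hsep
  have hμ := lfKernel_count_restrict hδ hsep
  have hmeas : Measurable fun x : Fin n₀ → E3 =>
      (gainSet n₀ k r ε R').indicator (1 : Measure E3 × (Fin n₀ → E3) → ℝ≥0∞)
        ((Measure.count : Measure E3).restrict S, x) :=
    (measurable_one.indicator (measurableSet_gainSet n₀ k r ε R')).comp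
      (measurable_const.prodMk measurable_id)
  rw [gainCount, Ne, lintegral_piKernel_eq_zero_iff hS hμ n₀ hmeas] at h
  push Not at h
  obtain ⟨xf, hxfS, hne⟩ := h
  have hmem : ((Measure.count : Measure E3).restrict S, xf) ∈ gainSet n₀ k r ε R' := by
    by_contra hnot
    exact hne (Set.indicator_of_notMem hnot _)
  obtain ⟨hinj, hr, hRinj, hRr, hRoff, hineq⟩ := hmem
  refine ⟨xf, hinj, Set.range_subset_iff.2 hxfS, hr, hRinj, hRr, ?_, ?_⟩
  · refine Set.disjoint_left.2 ?_
    rintro _ ⟨i, rfl⟩ ⟨hRS, hRx⟩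
    rcases hRoff i with h0 | hx
    · rw [hμ] at h0
      exact (count_restrict_singleton_ne_zero_iff S (R' i)).2 hRS h0
    · exact hRx hx
  · simp only [fieldOff_count_restrict hδ hsep] at hineq
    rw [fieldEnergy_eq, fieldEnergy_eq]
    exact hineq

/-- **Conversely, a gaining removal makes the gain count non-zero.** -/
theorem gainCount_ne_zero_of_gain {δ : ℝ} (hδ : 0 < δ) {S : Set E3}
    (hsep : ∀ x ∈ S, ∀ y ∈ S, x ≠ y → δ ≤ dist x y) {n₀ k : ℕ} {r ε : ℝ} {R' : Fin k → E3}
    (xf : Fin n₀ → E3) (hinj : Function.Injective xf) (hxfS : Set.range xf ⊆ S)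
    (hr : ∀ l, ‖xf l‖ ≤ r) (hRinj : Function.Injective R') (hRr : ∀ i, ‖R' i‖ ≤ r)
    (hdisj : Disjoint (Set.range R') (S \ Set.range xf))
    (hineq : interactionEnergy lennardJones R' + fieldEnergy lennardJones R' (S \ Set.range xf) -
          eStar * k + ε ≤
        interactionEnergy lennardJones xf + fieldEnergy lennardJones xf (S \ Set.range xf) -
          eStar * n₀) :
    gainCount n₀ k r ε R' ((Measure.count : Measure E3).restrict S) ≠ 0 := by
  have hS : S.Countable := countable_of_separated hδ hsep
  have hμ := lfKernel_count_restrict hδ hsep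
  have hmeas : Measurable fun x : Fin n₀ → E3 =>
      (gainSet n₀ k r ε R').indicator (1 : Measure E3 × (Fin n₀ → E3) → ℝ≥0∞)
        ((Measure.count : Measure E3).restrict S, x) :=
    (measurable_one.indicator (measurableSet_gainSet n₀ k r ε R')).comp
      (measurable_const.prodMk measurable_id)
  rw [gainCount, Ne, lintegral_piKernel_eq_zero_iff hS hμ n₀ hmeas]
  intro h
  have hmem : ((Measure.count : Measure E3).restrict S, xf) ∈ gainSet n₀ k r ε R' := by
    refine ⟨hinj, hr, hRinj, hRr, fun i => ?_, ?_⟩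
    · by_cases hx : R' i ∈ Set.range xf
      · exact Or.inr hx
      · left
        rw [hμ]
        by_contra hne
        have hRS : R' i ∈ S := (count_restrict_singleton_ne_zero_iff S (R' i)).1 hne
        exact Set.disjoint_left.1 hdisj (Set.mem_range_self i) ⟨hRS, hx⟩
    · simp only [fieldOff_count_restrict hδ hsep]
      rw [fieldEnergy_eq, fieldEnergy_eq] at hineq
      exact hineq
  have := h xf fun i => hxfS (Set.mem_range_self i)
  rw [Set.indicator_of_mem hmem, Pi.one_apply] at this
  exact one_ne_zero this

/-- Registered stub marker (helper part 7/14 of `stub_equilibriumInLaw`, line `equilibrium-in-law-surgery`):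
reading the measurable gain event back on counting measures, `exists_gain_of_gainCount_ne_zero`, closed form. -/
theorem stub_equilibriumInLaw_part07 :
    ∀ (δ : ℝ), 0 < δ → ∀ (S : Set (EuclideanSpace ℝ (Fin 3))), (∀ x ∈ S, ∀ y ∈ S, x ≠ y → δ ≤ dist x y) →
    ∀ (n₀ k : ℕ) (r ε : ℝ) (R' : Fin k → EuclideanSpace ℝ (Fin 3)),
    gainCount n₀ k r ε R' ((Measure.count : Measure (EuclideanSpace ℝ (Fin 3))).restrict S) ≠ 0 →
    ∃ xf : Fin n₀ → EuclideanSpace ℝ (Fin 3), Function.Injective xf ∧ Set.range xf ⊆ S ∧ (∀ l, ‖xf l‖ ≤ r) ∧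
      Function.Injective R' ∧ (∀ i, ‖R' i‖ ≤ r) ∧ Disjoint (Set.range R') (S \ Set.range xf) ∧
      interactionEnergy lennardJones R' + fieldEnergy lennardJones R' (S \ Set.range xf) - eStar * k + ε ≤
        interactionEnergy lennardJones xf + fieldEnergy lennardJones xf (S \ Set.range xf) - eStar * n₀ :=
  fun _ hδ _ hsep _ _ _ _ _ h => exists_gain_of_gainCount_ne_zero hδ hsep h

end Summit.AtomisticToContinuum.Crystallization.Theorems.PalmUnimodularRigidityMinimiserShells.EquilibriumInLaw.GainEvent

end
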